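import Summits.BirchSwinnertonDyer.BirchSwinnertonDyer.Theorems.ByReductionTypeAtTwoAdditivePotGoodPrintFamily56b1
import Literature.NumberTheory.EllipticCurves.AgasheRibetStein2006.ManinConstantOptimalCurves
import Literature.NumberTheory.EllipticCurves.HeightCovolumeBoundsProofs
import Summits.BirchSwinnertonDyer.BirchSwinnertonDyer.Theorems.Rank2ObservatoryRank3WitnessT3
import Literature.NumberTheory.EllipticCurves.IsogenyTwoTorsionProofs
import Literature.NumberTheory.EllipticCurves.IsogenyCompProofs
import HarnessLib

/-!
# K4 crux `AdditiveRankZeroAtTwo` (19098), children C3″ (22617) / C2″ (22616): the `56b1`-family with the PROVED theorems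
# of Cai–Li–Zhai (Thm. 1.1 + Thm. 1.5) instead of the §6.2 statement — BSD₂ (both halves, `Ш(W)[2^∞] = 0`) at every global
# minimal model of `56b1^{(M)}` from a CERTIFIED BASE, for the sub-family where `2` and `7` split in `ℚ(√M)`

Cell `bsd-2adic`, seat `bsd-2adic-k4-w2` GEN 5 (prover, explicit unit, no kit); `--supports stmt-BirchSwinnertonDyer-22617
--as helper`. HONEST FRAMING (D-0036/D-0054): audit-2 GEN 57's D-audit of `h62` (sheet
`D-AUDIT-h62-CLZ20-sec622-…`, evidence #9 on 22617) CONFIRMED the flag inherited by `…PrintFamily56b1.lean`: in CLZ §6.2.2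
the `L`-value half is Thm. 1.1 (proved), but the `pPartBSD` conjunct for `56b1^{(M)}` has no printed proof; its upgrade path
R2 is «#Q even: Thm. 1.5 + two certificates + the tree's `P2.bsdp_two_twist_of_caiLiZhai`». This file is that road, with
the K4 habitat attached: inputs BY NAME = CLZ Thm. 1.1 (`thm11_ord_two_LAlg_twist`) and Thm. 1.5 (`thm15_twoPartBSD_twist`)
— both PROVED in print —, Agashe–Ribet–Stein 2006 Thm. 2.6 (`cremona_abs_maninConstant_eq_one_of_level_le`, for the odd
Manin constant: `N(56b1) ≤ |Δ_min| = 7168 ≤ 130000` in the kernel), modularity, GZK; KERNEL = `#56b1(ℚ)[2] = 2` (`natCard_twoTorsion_C56B1`, reduction mod `3`), `56b1` global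
minimal (`isGloballyMinimal_C56B1`), `N ≤ 7168`; DISPLAYED = the optimal datum (`Dt`, `hopt`), the record
`ord₂(L(56b1,1)/Ω) = −1` (Cremona: `L/Ω = 1/2`), the two
CERTIFICATES at the base (`Ш(56b1′)[2] = 0` for the `2`-isogenous curve, `BSD(56b1, 2)` — record tier), the twisting
primes `q ∈ 𝒮(56b1)` (`q ≡ 1 (mod 4)`, `q ∤ 56`, `ord₂ N_q = 1`) and Thm. 1.5 (2) «`2`, `7` split in `ℚ(√M)`» (`M ≡ 1 (mod 8)`,
`(M/7) = 1`). Closes nothing at the `∀`-level; BSD is not proved by any of this.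

WHAT IS PROVED (0 `def`, 0 `sorry`): `printFamily56b1_of_thm15` — under the inputs above, every global minimal
`W ≅ 56b1^{(M)}`, `M = ∏ Q`, has `r_an(W) = 0`, is ADDITIVE and POTENTIALLY GOOD at `2`, NON-CM, with `W[2]` REDUCIBLE
(`habitat_smul_twist56`), `Ш(W)(2) = 0`, `BSD(W, 2)`, `MissingLowerBoundAt W 2` and `MissingUpperBoundAt W 2`.

References: [CaiLiZhai2019] Thm. 1.1, Thm. 1.5; [AgasheRibetStein2006] Thm. 2.6; [Miller2011LMS] Def. 1.1;
[SilvermanAEC2009] VII.5, VIII.8.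
-/

set_option autoImplicit false
set_option linter.dupNamespace false

noncomputable section

open scoped Classical

open WeierstrassCurve Literature.NumberTheory.EllipticCurves
  Literature.NumberTheory.EllipticCurves.Rank1Residual
  Literature.NumberTheory.EllipticCurves.Rank1Residual.Typed
  Literature.NumberTheory.EllipticCurves.CaiLiZhai2019
  Literature.NumberTheory.EllipticCurves.ModularForms
  Literature.NumberTheory.EllipticCurves.AgasheRibetStein2006
  Summit.BirchSwinnertonDyer.Rank1Residual
  Summit.BirchSwinnertonDyer.Rank1Residual.X5.O1
  Summit.BirchSwinnertonDyer.Rank1Residual.P2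
  Summit.BirchSwinnertonDyer.BirchSwinnertonDyer.Rank1Residual.IntModel

namespace Summit.BirchSwinnertonDyer.BirchSwinnertonDyer.Theorems.AddPotGoodPrint

/-- The integer equation `[0,−1,0,0,−4]` base-changes to `56b1`. [folklore] -/
theorem C56B1Int_map : (⟨0, -1, 0, 0, -4⟩ : WeierstrassCurve ℤ).map (Int.castRingHom ℚ) = C56B1 := by
  ext <;> simp [C56B1, WeierstrassCurve.map]

/-- **`56b1` is a global minimal model — IN THE KERNEL** (`Δ = −2¹⁰·7`: `ord_p Δ < 12` at every prime; the
case `M = 1` of `isGloballyMinimal_twist56`). [cite: CaiLiZhai2019, §6.2.2] [cite: SilvermanAEC2009, VII.1 Remark 1.1] -/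
theorem isGloballyMinimal_C56B1 : C56B1.IsGloballyMinimal := by
  have h := isGloballyMinimal_twist56 1 one_ne_zero (by decide)
    (fun q hq h => by have := Nat.le_of_dvd one_pos h; have := hq.two_le; nlinarith)
  have e : (⟨0, -((1 : ℕ) : ℚ), 0, 0, -4 * ((1 : ℕ) : ℚ) ^ 3⟩ : WeierstrassCurve ℚ) = C56B1 := by
    ext <;> simp [C56B1]
  exact e ▸ h

/-- In a group whose `2`-torsion is `{0, T}` with `T ≠ 0`, `2•T = 0`, the `2`-torsion subtype has exactly two elements
(adapted from the private helper of `P2/ShuZhaiTwoFiftySixCurve.lean`). [folklore] -/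
private theorem natCard_twoTorsion_eq_two_of_subset {A : Type*} [AddCommGroup A] {T : A} (hT0 : T ≠ 0)
    (hT2 : (2 : ℕ) • T = 0) (h : ∀ τ : A, (2 : ℤ) • τ = 0 → τ = 0 ∨ τ = T) :
    Nat.card {P : A // (2 : ℕ) • P = 0} = 2 := by
  rw [Nat.card_eq_two_iff]
  refine ⟨⟨0, smul_zero _⟩, ⟨T, hT2⟩, fun he => hT0 (Subtype.mk.inj he).symm, ?_⟩
  ext ⟨τ, hτ⟩
  simp only [Set.mem_insert_iff, Set.mem_singleton_iff, Set.mem_univ, iff_true]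
  have hτ' : (2 : ℤ) • τ = 0 := by rw [← natCast_zsmul] at hτ; exact_mod_cast hτ
  rcases h τ hτ' with rfl | rfl
  · exact Or.inl rfl
  · exact Or.inr rfl

open Summit.BirchSwinnertonDyer.BirchSwinnertonDyer.Rank2Observatory in
/-- **`#56b1(ℚ)[2] = 2` — IN THE KERNEL** (CLZ's hypothesis `E[2](ℚ) ≅ ℤ/2` of Thm. 1.1/1.5 at the base):
`x³ − x² − 4 = (x − 2)(x² + x + 2)`, so `T = (2, 0)` is rational `2`-torsion, and modulo the good odd prime `3` the only
affine `2`-torsion point of `Ẽ(𝔽₃)` is `T̃` (`x² + x + 2` has no root mod `3`; Boolean certificate `twoTorsionOnlyB`,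
`decide +kernel`); prime-to-`3` torsion injects (tree `Rank2Observatory.twoTorsion_eq_zero_or_eq`).
[cite: CaiLiZhai2019, Thm. 1.1 hypothesis `E[2](ℚ) ≅ ℤ/2ℤ`, §6.2.2] [cite: SilvermanAEC2009, Prop. VII.3.1(b)] -/
theorem natCard_twoTorsion_C56B1 : Nat.card {P : C56B1.toAffine.Point // (2 : ℕ) • P = 0} = 2 := by
  rw [← C56B1Int_map]
  haveI : Fact (Nat.Prime 3) := ⟨by norm_num⟩
  set V : WeierstrassCurve ℤ := ⟨0, -1, 0, 0, -4⟩ with hV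
  have hT : (0 : ℤ) ^ 2 + V.a₁ * 2 * 0 + V.a₃ * 0 = 2 ^ 3 + V.a₂ * 2 ^ 2 + V.a₄ * 2 + V.a₆ := by
    simp [hV]
  have hT2 : 2 * (0 : ℤ) + V.a₁ * 2 + V.a₃ = 0 := by simp [hV]
  have hΔ : ¬ ((3 : ℕ) : ℤ) ∣ V.Δ := by
    simp only [hV, WeierstrassCurve.Δ, WeierstrassCurve.b₂, WeierstrassCurve.b₄,
      WeierstrassCurve.b₆, WeierstrassCurve.b₈]
    norm_num
  have hB : twoTorsionOnlyB V 3 2 0 = true := by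
    rw [hV]; decide +kernel
  have h := twoTorsion_eq_zero_or_eq V hT hT2 3 hΔ (by norm_num) hB
  haveI := isElliptic_rat V (Δ_ne_zero_of_not_dvd V hΔ)
  refine natCard_twoTorsion_eq_two_of_subset (Affine.Point.some_ne_zero _) ?_ h
  exact two_nsmul_some_eq_zero V (Δ_ne_zero_of_not_dvd V hΔ) hT hT2

/-- **Odd Manin constant of an optimal datum of `56b1` BY PRINT**: `N(56b1) ≤ |Δ_min| = 7168 ≤ 130000` (the tree's
`conductorNorm_le_abs_Δ`, `Δ(56b1) = −7168`), so Agashe–Ribet–Stein Thm. 2.6 gives `|c| = 1`, in particular `2 ∤ c` — CLZ's hypothesis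
«`E` has odd Manin constant» in the tree's `IsOptimalDatumWithOddManinConstant`. [cite: AgasheRibetStein2006, Thm. 2.6] -/
theorem isOptimalDatumWithOddManinConstant_C56B1 (h26 : cremona_abs_maninConstant_eq_one_of_level_le)
    [C56B1.IsElliptic] [C56B1.IsGloballyMinimal] [NeZero (C56B1.conductorNorm ℤ)]
    (Dt : ModularParametrizationData C56B1 (C56B1.conductorNorm ℤ))
    (hopt : ∀ z ∈ Dt.L.lattice, ∃ w ∈ periodLattice Dt.f, z = Dt.c * w) :
    IsOptimalDatumWithOddManinConstant C56B1 Dt := by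
  refine ⟨hopt, fun hdvd => ?_⟩
  have hN : C56B1.conductorNorm ℤ ≤ 130000 := by
    have h := conductorNorm_le_abs_Δ C56B1
    rw [Δ_C56B1] at h
    norm_num at h
    exact le_trans (by exact_mod_cast h) (by norm_num : (7168 : ℕ) ≤ 130000)
  have h := h26 _ Dt hopt hN
  have h1 : Dt.maninConstant.natAbs = 1 := by
    rw [Int.abs_eq_natAbs] at h; exact_mod_cast h
  have := Int.natAbs_dvd_natAbs.mpr hdvd
  rw [h1] at this
  norm_num at this

/-- **BSD₂ (both halves, `Ш[2^∞] = 0`) on the `56b1`-family from Cai–Li–Zhai Thm. 1.1 + Thm. 1.5 (PROVED theorems) and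
a CERTIFIED BASE**, with the K4 habitat. Base data: optimal datum (`Dt`, `hopt`; Manin constant odd by ARS Thm. 2.6 and
`N ≤ |Δ| = 7168`), `#56b1(ℚ)[2] = 2` (KERNEL, `natCard_twoTorsion_C56B1`), `ord₂(L(56b1,1)/Ω) = −1` (`hL`), the `2`-isogenous
curve `W′` with `#ker = 2` and `Ш(W′)[2] = 0` (`φ`, `hker`, `hSha'`) and `BSD(56b1, 2)` (`hbase`) — record-tier certificates;
instance binders dischargeable by `isElliptic_C56B1`, `isGloballyMinimal_C56B1`, `neZero_conductorNorm_of_isElliptic`; twisting data: `Q ⊆ 𝒮(56b1)` nonempty (`q ≡ 1 (mod 4)`, `q ∤ N`, `ord₂ N_q = 1`) and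
«every `ℓ ∣ 2N` splits in `ℚ(√M)`» (`hsplit`). Conclusion at every global minimal `W ≅ 56b1^{(M)}`: `r_an(W) = 0`, `Addv W 2`,
`0 ≤ ord₂ j(W)`, `¬CM`, `Red W 2`, `Ш(W)(2) = 0`, `BSD(W, 2)`, `MissingLowerBoundAt W 2`, `MissingUpperBoundAt W 2`.
[cite: CaiLiZhai2019, Thm. 1.1 and Thm. 1.5 (arXiv:1712.01271 §1, chunks p0003 L25–L37, p0004 L6–L13)] [cite: Miller2011LMS, Def. 1.1] -/
theorem printFamily56b1_of_thm15 (h11 : thm11_ord_two_LAlg_twist) (h15 : thm15_twoPartBSD_twist)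
    (h26 : cremona_abs_maninConstant_eq_one_of_level_le) (hmod : hasEntireLFunction_rat)
    (hGZK : rank_eq_analyticRank_of_analyticRank_le_one)
    [C56B1.IsElliptic] [C56B1.IsGloballyMinimal] [NeZero (C56B1.conductorNorm ℤ)]
    (Dt : ModularParametrizationData C56B1 (C56B1.conductorNorm ℤ))
    (hopt : ∀ z ∈ Dt.L.lattice, ∃ w ∈ periodLattice Dt.f, z = Dt.c * w)
    (hL : ∃ q : ℚ, C56B1.entireLFunction 1 = (q : ℂ) * (C56B1.realPeriodRat : ℂ) ∧ padicValRat 2 q = -1)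
    (W' : WeierstrassCurve ℚ) (φ : Isogeny C56B1 W') (hker : Nat.card φ.toAddMonoidHom.ker = 2)
    (hSha' : ∀ x ∈ W'.sha, (2 : ℕ) • x = 0 → x = 0) (hbase : BSDp C56B1 2)
    (Q : Finset ℕ) (hQ : Q.Nonempty) (hS : ∀ q ∈ Q, InS C56B1 q)
    (hsplit : ∀ (K : Type) [Field K] [NumberField K], Module.finrank ℚ K = 2 →
      (∃ x : K, x ^ 2 = ((∏ q ∈ Q, q : ℕ) : K)) → SatisfiesHeegnerHypothesis (2 * C56B1.conductorNorm ℤ) K)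
    (W : WeierstrassCurve ℚ) [W.IsElliptic] [W.IsGloballyMinimal]
    (hW : ∃ C : VariableChange ℚ, C • C56B1.quadraticTwist ((∏ q ∈ Q, q : ℕ) : ℚ) = W) :
    W.analyticRank = 0 ∧ Addv W 2 ∧ 0 ≤ padicValRat 2 W.j ∧ ¬ W.HasCM ∧ Red W 2 ∧
      AddCommGroup.primaryComponent W.sha 2 = ⊥ ∧ BSDp W 2 ∧ MissingLowerBoundAt W 2 ∧ MissingUpperBoundAt W 2 := by
  haveI : Fact (Nat.Prime 2) := ⟨Nat.prime_two⟩
  obtain ⟨hr, hSha, hB⟩ := bsdp_two_twist_of_caiLiZhai h11 h15 hmod hGZK Dt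
    (isOptimalDatumWithOddManinConstant_C56B1 h26 Dt hopt) natCard_twoTorsion_C56B1 hL Q hQ hS hW W' φ hker hSha'
    hsplit hbase
  haveI : Finite W.sha := (hGZK W (by omega)).2
  have hLU := lower_and_upper_of_missingPPartAt W 2 (missingPPartAt_of_bsdp W 2 hB)
  have hS1 : ∀ q ∈ Q, q.Prime := fun q hq => (hS q hq).1
  obtain ⟨C, rfl⟩ := hW
  have hab := habitat_smul_twist56 (∏ q ∈ Q, q) (prod_ne_zero_of_primes hS1)
    (not_two_dvd_prod_of_mod_four fun q hq => ⟨(hS q hq).1, (hS q hq).2.1⟩) (not_sq_dvd_prod_of_primes hS1) C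
  exact ⟨hr, hab.1, hab.2.1, hab.2.2.1, hab.2.2.2, hSha, hB, hLU⟩

/-! ## Appended: the `2`-isogeny `56b1 → 56b2` and its kernel of order `2` — IN THE KERNEL

CLZ Thm. 1.5 is applied (through `P2.bsdp_two_twist_of_caiLiZhai`) with a rational `2`-isogeny `φ : E → E′`, `#ker φ = 2`,
and the certificate `Ш(E′)[2] = 0`. For `E = 56b1` the isogeny is constructed here: translating `x ↦ x + 2` puts `56b1`
in two-torsion normal form `y² = x³ + 5x² + 8x` (`shift_C56B1_eq`), Silverman's explicit `2`-isogeny (tree `twoIsogeny`,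
degree `2`) lands in `E′ : y² = x³ − 10x² − 7x` (`twoIsogenyCodomain_shift_C56B1`; `Δ(E′) = 2¹¹·7²`, a model of `56b2`),
and precomposing with the change of variables (tree `VariableChange.toIsogeny`, a bijection on `K̄`-points) does not
change `#ker` (`natCard_ker_comp_toIsogeny`). Net effect: `printFamily56b1_of_thm15_kernelIsogeny` displays only the
optimal datum, `ord₂ L^alg(56b1) = −1`, `Ш(E′)[2] = 0` for the EXPLICIT `E′ = [0,−10,0,−7,0]`, and `BSD(56b1, 2)`. -/

/-- **Precomposing an isogeny with an admissible change of variables does not change `#ker`** (the change of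
variables is a bijection on `K̄`-points: tree `toIsogeny_injective` / `toIsogeny_surjective`; `ker (ψ ∘ ι) = ι⁻¹(ker ψ)`).
[cite: SilvermanAEC2009, III.4 (degree of a composite) and III.3.1(b)] -/
theorem natCard_ker_comp_toIsogeny {V V' : WeierstrassCurve ℚ} (C : VariableChange ℚ) (ψ : Isogeny (C • V) V') :
    Nat.card (ψ.comp (VariableChange.toIsogeny V C)).toAddMonoidHom.ker = Nat.card ψ.toAddMonoidHom.ker := by
  have hbij : Function.Bijective (VariableChange.toIsogeny V C) :=
    ⟨VariableChange.toIsogeny_injective V C, VariableChange.toIsogeny_surjective V C⟩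
  refine Nat.card_congr
    { toFun := fun P => ⟨VariableChange.toIsogeny V C P.1, ?_⟩
      invFun := fun Q => ⟨(Equiv.ofBijective _ hbij).symm Q.1, ?_⟩
      left_inv := fun P => Subtype.ext (Equiv.ofBijective_symm_apply_apply _ hbij P.1)
      right_inv := fun Q => Subtype.ext (Equiv.ofBijective_apply_symm_apply _ hbij Q.1) }
  · have h := P.2
    rw [AddMonoidHom.mem_ker] at h ⊢
    exact h
  · have h := Q.2
    rw [AddMonoidHom.mem_ker] at h ⊢
    show ψ (VariableChange.toIsogeny V C ((Equiv.ofBijective _ hbij).symm Q.1)) = 0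
    rw [Equiv.ofBijective_apply_symm_apply (VariableChange.toIsogeny V C) hbij Q.1]
    exact h

/-- **`56b1` in two-torsion normal form**: the translation `x ↦ x + 2` (change of variables `(u,r,s,t) = (1,2,0,0)`) carries
`y² = x³ − x² − 4` to `y² = x³ + 5x² + 8x`, with the rational `2`-torsion point at `(0,0)`. [cite: SilvermanAEC2009, III.1 and III.4 Example 4.5] -/
theorem shift_C56B1_eq : (⟨1, 2, 0, 0⟩ : VariableChange ℚ) • C56B1 = (⟨0, 5, 0, 8, 0⟩ : WeierstrassCurve ℚ) := by
  ext
  · simp [C56B1, variableChange_a₁]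
  · simp [C56B1, variableChange_a₂]; norm_num
  · simp [C56B1, variableChange_a₃]
  · simp [C56B1, variableChange_a₄]; norm_num
  · simp [C56B1, variableChange_a₆]; norm_num

/-- The translated `56b1` is in two-torsion normal form (`a₁ = a₃ = a₆ = 0`). [cite: SilvermanAEC2009, III.4 Example 4.5] -/
theorem isTwoTorsionNF_shift_C56B1 : ((⟨1, 2, 0, 0⟩ : VariableChange ℚ) • C56B1).IsTwoTorsionNF := by
  rw [shift_C56B1_eq]; exact ⟨rfl, rfl, rfl⟩

/-- **The `2`-isogenous curve `E′ = 56b1/⟨T⟩ : y² = x³ − 10x² − 7x`** (Silverman's `Y² = X³ − 2aX² + (a² − 4b)X` with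
`a = 5`, `b = 8`; `Δ(E′) = 2¹¹·7²`, a model of `56b2`). [cite: SilvermanAEC2009, III.4 Example 4.5] -/
theorem twoIsogenyCodomain_shift_C56B1 :
    ((⟨1, 2, 0, 0⟩ : VariableChange ℚ) • C56B1).twoIsogenyCodomain = (⟨0, -10, 0, -7, 0⟩ : WeierstrassCurve ℚ) := by
  rw [shift_C56B1_eq]
  ext <;> norm_num [WeierstrassCurve.twoIsogenyCodomain]

/-- **The rational `2`-isogeny `φ : 56b1 → E′` has `#ker φ(ℚ̄) = 2` — IN THE KERNEL** (`φ` = Silverman's `2`-isogeny of the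
translated curve precomposed with the translation; `#ker = deg = 2` by `degree_twoIsogeny` and `natCard_ker_comp_toIsogeny`).
[cite: SilvermanAEC2009, III.4 Example 4.5] [cite: CaiLiZhai2019, Thm. 1.5 (the `2`-isogeny `E → E′`)] -/
theorem natCard_ker_twoIsogeny_C56B1 [C56B1.IsElliptic] :
    haveI := isTwoTorsionNF_shift_C56B1
    Nat.card ((((⟨1, 2, 0, 0⟩ : VariableChange ℚ) • C56B1).twoIsogeny).comp
      (VariableChange.toIsogeny C56B1 ⟨1, 2, 0, 0⟩)).toAddMonoidHom.ker = 2 := by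
  haveI := isTwoTorsionNF_shift_C56B1
  rw [natCard_ker_comp_toIsogeny]
  exact degree_twoIsogeny _

/-- **`printFamily56b1_of_thm15` with the `2`-isogeny DISCHARGED**: the same conclusion (`r_an = 0`, additive potentially
good at `2`, `0 ≤ ord₂ j`, non-CM, `W[2]` reducible, `Ш(W)(2) = 0`, `BSD(W, 2)`, both K4 halves) at every global minimal
`W ≅ 56b1^{(∏Q)}`, now displaying only: the optimal datum (`Dt`, `hopt`), the record `ord₂(L(56b1,1)/Ω) = −1` (`hL`), the
certificate `Ш(E′)[2] = 0` for the EXPLICIT `2`-isogenous curve `E′ = [0,−10,0,−7,0]` (`hSha'`), the certificate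
`BSD(56b1, 2)` (`hbase`), and the twisting data (`Q ⊆ 𝒮(56b1)`, `2N`-split). Inputs BY NAME: CLZ Thm. 1.1, Thm. 1.5,
ARS Thm. 2.6, modularity, GZK. BSD is not proved by any of this.
[cite: CaiLiZhai2019, Thm. 1.1 and Thm. 1.5] [cite: AgasheRibetStein2006, Thm. 2.6] [cite: Miller2011LMS, Def. 1.1] -/
theorem printFamily56b1_of_thm15_kernelIsogeny (h11 : thm11_ord_two_LAlg_twist) (h15 : thm15_twoPartBSD_twist)
    (h26 : cremona_abs_maninConstant_eq_one_of_level_le) (hmod : hasEntireLFunction_rat)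
    (hGZK : rank_eq_analyticRank_of_analyticRank_le_one)
    [C56B1.IsElliptic] [C56B1.IsGloballyMinimal] [NeZero (C56B1.conductorNorm ℤ)]
    (Dt : ModularParametrizationData C56B1 (C56B1.conductorNorm ℤ))
    (hopt : ∀ z ∈ Dt.L.lattice, ∃ w ∈ periodLattice Dt.f, z = Dt.c * w)
    (hL : ∃ q : ℚ, C56B1.entireLFunction 1 = (q : ℂ) * (C56B1.realPeriodRat : ℂ) ∧ padicValRat 2 q = -1)
    (hSha' : ∀ x ∈ (⟨0, -10, 0, -7, 0⟩ : WeierstrassCurve ℚ).sha, (2 : ℕ) • x = 0 → x = 0) (hbase : BSDp C56B1 2)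
    (Q : Finset ℕ) (hQ : Q.Nonempty) (hS : ∀ q ∈ Q, InS C56B1 q)
    (hsplit : ∀ (K : Type) [Field K] [NumberField K], Module.finrank ℚ K = 2 →
      (∃ x : K, x ^ 2 = ((∏ q ∈ Q, q : ℕ) : K)) → SatisfiesHeegnerHypothesis (2 * C56B1.conductorNorm ℤ) K)
    (W : WeierstrassCurve ℚ) [W.IsElliptic] [W.IsGloballyMinimal]
    (hW : ∃ C : VariableChange ℚ, C • C56B1.quadraticTwist ((∏ q ∈ Q, q : ℕ) : ℚ) = W) :
    W.analyticRank = 0 ∧ Addv W 2 ∧ 0 ≤ padicValRat 2 W.j ∧ ¬ W.HasCM ∧ Red W 2 ∧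
      AddCommGroup.primaryComponent W.sha 2 = ⊥ ∧ BSDp W 2 ∧ MissingLowerBoundAt W 2 ∧ MissingUpperBoundAt W 2 := by
  haveI := isTwoTorsionNF_shift_C56B1
  have hSha'' : ∀ x ∈ (((⟨1, 2, 0, 0⟩ : VariableChange ℚ) • C56B1).twoIsogenyCodomain).sha,
      (2 : ℕ) • x = 0 → x = 0 := by
    rw [twoIsogenyCodomain_shift_C56B1]; exact hSha'
  exact printFamily56b1_of_thm15 h11 h15 h26 hmod hGZK Dt hopt hL _ _ natCard_ker_twoIsogeny_C56B1 hSha'' hbase Q hQ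
    hS hsplit W hW

end Summit.BirchSwinnertonDyer.BirchSwinnertonDyer.Theorems.AddPotGoodPrint

end
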